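import Summits.ResolutionOfSingularities.ResolutionOfSingularities.Theorems.WeightedInvariantTerminatingCentreDatum
import Summits.ResolutionOfSingularities.ResolutionOfSingularities.Theorems.WeightedInvariantDatumToEmbedded
import Summits.ResolutionOfSingularities.ResolutionOfSingularities.Theorems.WeightedInvariantWeightedThesisHypersurfaceTower
import HarnessLib

/-!
# Terminating weighted-centre data — conversions from the old data and the consumers (part 1/2: all pairs)

Split note: the planner's consumer module (res-wc-repair-plan-1, sha16 6b666e32f4956d86, 544 lines) is filed as TWO
Theorems files for the 400-line lint — this BASE part (lines 1–272 byte-identical: `maxBot`, and everything in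
namespace `TerminatingCentreDatum`: `ofDatum`, `nonempty_of_nonempty`, the closed-immersion readings, the consumers on
all pairs) and `WeightedInvariantTerminatingCentreDatumConsumer.lean` (lines 274–540: the `HypersurfaceTerminatingCentreDatum`
part), which imports this one and keeps the planner's module name for the downstream files.

Companion of `WeightedInvariantTerminatingCentreDatum.lean` (route `ResolutionOfSingularities/WeightedInvariant`,
repair planner `res-wc-repair-plan-1`).  This module imports the route file (through the landed tower
modules), so it cannot be imported by it; it carries everything about the relaxed interfaces that needs
the landed consumer of the old datum:

* `TerminatingCentreDatum.ofDatum : WeightedResolutionDatum p → TerminatingCentreDatum p` and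
  `HypersurfaceTerminatingCentreDatum.ofHypersurfaceDatum : HypersurfaceResolutionDatum p → …` — the
  re-typed doors are IMPLIED by the old ones (rank := `max inv ∈ WithBot Γ`; `(term)` is the landed drop
  of `max inv` on the global cobordant blow-up; `(hom)` the landed homogeneity of the centre);
* the closed-immersion readings of `(ii)` and "the generic point is off the centre";
* the CONSUMERS, sorry-free modulo Bergh–Rydh over the field at hand:
  `TerminatingCentreDatum.hasResolution_of_closedImmersion` (every integral closed subscheme of a
  smooth separated quasi-compact `Y/k`) and `HypersurfaceTerminatingCentreDatum.hasResolution_field`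
  (every reduced separated `k`-scheme of finite type, through the landed hypersurface reduction) — the
  tower `HypersurfaceTower.hasResolution_quotient_of_gradedAtlas` run with the datum-free lemmas
  (`smooth_πPlus_comp_of_isRegularWeightedCentre`, `isIntegral_strictTransformPlus_of_not_mem_support`,
  `quotientStep_of_isRegularWeightedCentre`, `quotientSingularities_of_regular`, `stub_initialAtlas`)
  and the rank engines.
Nothing here asserts that such data exist.
-/

noncomputable section

open CategoryTheory CategoryTheory.Limits AlgebraicGeometry TopologicalSpace
open Literature.AlgebraicGeometry.Resolution

set_option linter.dupNamespace false -- mandated namespace of this single-conjunct summit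

namespace Summit.ResolutionOfSingularities.ResolutionOfSingularities.Theorems

/-! ## A maximum as an element of `WithBot` -/

/-- The maximum VALUE of `ι : α → Γ` as an element of `WithBot Γ` — `⊥` when `ι` attains no maximum
(e.g. `α` empty). Used as the rank of the old data. [folklore] -/
def maxBot {α Γ : Type*} [LinearOrder Γ] (ι : α → Γ) : WithBot Γ :=
  haveI := Classical.propDecidable (∃ a : α, ∀ a' : α, ι a' ≤ ι a)
  if h : ∃ a : α, ∀ a' : α, ι a' ≤ ι a then (ι h.choose : WithBot Γ) else ⊥

/-- If `ι` attains a maximum, `maxBot ι` is the value at some maximum point. [folklore] -/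
theorem exists_maxBot_eq {α Γ : Type*} [LinearOrder Γ] (ι : α → Γ)
    (hM : ∃ a : α, ∀ a' : α, ι a' ≤ ι a) :
    ∃ a₀ : α, (∀ a' : α, ι a' ≤ ι a₀) ∧ maxBot ι = (ι a₀ : WithBot Γ) := by
  refine ⟨hM.choose, hM.choose_spec, ?_⟩
  unfold maxBot
  rw [dif_pos hM]

/-- If `ι` is everywhere strictly below `γ`, then `maxBot ι < γ`. [folklore] -/
theorem maxBot_lt_coe {α Γ : Type*} [LinearOrder Γ] (ι : α → Γ) {γ : Γ} (h : ∀ a : α, ι a < γ) :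
    maxBot ι < (γ : WithBot Γ) := by
  unfold maxBot
  split_ifs with hM
  · exact WithBot.coe_lt_coe.mpr (h _)
  · exact WithBot.bot_lt_coe γ

namespace TerminatingCentreDatum

variable {p : ℕ}

/-! ## Every weighted resolution datum is a terminating centre datum -/

/-- **Every weighted resolution datum is a terminating centre datum** (so the re-typed door crux is
IMPLIED by the old one): keep `Γ`, `inv`, `centre`; take `Λ := WithBot Γ` and `rank := max inv`;
`(iii-b′)` from exact support `(iii)`; `(hom)` is the landed `CentreHomogeneous.stub_centre_isHomogeneous`
(functoriality for the torus action maps); `(term)` is the landed drop of `max inv` on the global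
cobordant blow-up (`InvDrop.stub_inv_drop`: locality of `inv` + axiom `(iv)`, on the smooth separated
quasi-compact `B₊` of `GlobalCobordantPlus.stub_smooth_globalCobordantPlus`). [folklore] -/
def ofDatum (D : WeightedResolutionDatum p) : TerminatingCentreDatum p where
  Γ := D.Γ
  inv := D.inv
  centre := D.centre
  Λ := WithBot D.Γ
  rank := fun _ _ _ f X => maxBot (D.inv f X)
  isBot_inv_iff := fun _ _ _ _ _ f _ _ _ X y => D.isBot_inv_iff f X y
  isRegularWeightedCentre_centre := fun _ _ _ _ _ f _ _ _ X h =>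
    D.isRegularWeightedCentre_centre f X h
  support_centre_subset := fun _ _ _ _ _ f _ _ _ X h y hy => by
    rw [D.support_centre f X h] at hy
    exact D.not_isBot_of_isMaxOn f X h hy
  centre_isHomogeneous := fun _ _ _ _ _ f _ _ _ X h j W 𝒜 _ h0 hX n =>
    DatumToEmbedded.CentreHomogeneous.stub_centre_isHomogeneous D f X h W 𝒜 h0 hX n
  rank_lt := fun _ _ _ _ _ f _ _ _ X h R' hR' => by
    obtain ⟨y₁, hy₁⟩ := h
    haveI : Nonempty _ := ⟨y₁⟩
    obtain ⟨y₀, hy₀, hmax⟩ := exists_maxBot_eq (D.inv f X) (exists_isMax_inv D f X)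
    obtain ⟨hsm, hsep, hqc⟩ :=
      WeightedThesis.GlobalCobordantPlus.stub_smooth_globalCobordantPlus D f X ⟨y₁, hy₁⟩ R' hR'
    haveI := hsm; haveI := hsep; haveI := hqc
    have hdrop := DatumToEmbedded.InvDrop.stub_inv_drop D f X ⟨y₁, hy₁⟩ y₀ hy₀ R' hR'
    show maxBot (D.inv (R'.πPlus ≫ f) (R'.strictTransformPlus X)) < maxBot (D.inv f X)
    rw [hmax]
    exact maxBot_lt_coe _ hdrop

/-- `ofDatum` keeps the rating. [folklore] -/
@[simp] theorem ofDatum_inv (D : WeightedResolutionDatum p) : (ofDatum D).inv = D.inv := rfl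

/-- `ofDatum` keeps the centre. [folklore] -/
@[simp] theorem ofDatum_centre (D : WeightedResolutionDatum p) : (ofDatum D).centre = D.centre := rfl

/-- Hence the old door crux implies the re-typed one, prime by prime. [folklore] -/
theorem nonempty_of_nonempty (h : Nonempty (WeightedResolutionDatum p)) :
    Nonempty (TerminatingCentreDatum p) :=
  h.map ofDatum

/-! ## `(ii)` and `(iii-b′)` on a closed immersion -/

section Basic

variable (E : TerminatingCentreDatum p) {k : Type} [Field k] [CharP k p] [PerfectField k]
  {Y X : Scheme.{0}} (f : Y ⟶ Spec (.of k)) [Smooth f] [IsSeparated f] [QuasiCompact f]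
  (i : X ⟶ Y) [IsClosedImmersion i]

/-- `(ii)` read on a closed immersion: `inv` of `(Y, ker i)` is everywhere minimal iff `X` is regular.
[folklore] -/
theorem isRegular_iff_forall_isBot_inv :
    Scheme.IsRegular X ↔ ∀ y : Y, IsBot (E.inv f i.ker y) :=
  (isRegular_iff_isRegular_image i).trans (E.forall_isBot_inv_iff f i.ker).symm

/-- `(ii)` at a point of `X`: `inv` is minimal at `i x` iff `𝒪_{X,x}` is regular. [folklore] -/
theorem isBot_inv_apply_iff (x : X) :
    IsBot (E.inv f i.ker (i x)) ↔ IsRegularLocalRing (X.presheaf.stalk x) := by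
  rw [E.isBot_inv_iff f i.ker (i x)]
  constructor
  · intro h
    exact (isRegularLocalRing_stalk_image_iff i x).mp
      (h (i.toImage x) ((toImage_apply_eq_iff i x _).mpr rfl))
  · intro h x' hx'
    obtain ⟨x₀, rfl⟩ := i.toImage.surjective x'
    rw [toImage_apply_eq_iff] at hx'
    have hx₀ : x₀ = x := i.isClosedEmbedding.injective hx'
    subst hx₀
    exact (isRegularLocalRing_stalk_image_iff i x₀).mpr h

/-- **The generic point of the integral `X` is off the centre** — the hypothesis `hξ` of the
datum-free tower lemmas: its local ring (the function field) is regular, so `inv` is minimal there by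
`(ii)`, while the centre lies in the non-minimal locus by `(iii-b′)`. [folklore] -/
theorem genericPoint_not_mem_support_centre [IsIntegral X]
    (hguard : ∃ y : Y, ¬ IsBot (E.inv f i.ker y)) :
    i (genericPoint X) ∉ (E.centre f i.ker).support := by
  have hbot : IsBot (E.inv f i.ker (i (genericPoint X))) := by
    rw [E.isBot_inv_apply_iff f i]
    change IsRegularLocalRing X.functionField
    infer_instance
  intro hmem
  exact E.support_centre_subset f i.ker hguard hmem hbot

end Basic

/-! ## The consumer on all pairs (Włodarczyk's tower with the datum-free lemmas) -/

/-- **Every torus-quotient presentation of an integral closed subscheme of `Y/k` has a resolved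
quotient, granted a terminating centre datum at `p = char k` and Bergh–Rydh over `k`** — the tower of
`DatumToEmbedded.hasResolution_quotient_of_gradedAtlas` run on the RELAXED interface: induction on the
rank of pairs (`rank_induction`); base: `inv` everywhere minimal ⇒ `X` regular (`(ii)`) ⇒ finite
diagonalizable quotient singularities (`DatumToEmbedded.quotientSingularities_of_regular`) ⇒ Bergh–Rydh;
step: the centre is a regular weighted centre (`(iii-a)`) off the generic point (`(ii)`+`(iii-b′)`),
global cobordant blow-up (`smooth_πPlus_comp_of_isRegularWeightedCentre`), integral strict transform
(`isIntegral_strictTransformPlus_of_not_mem_support`), homogeneity on the atlas charts (`(hom)`), quotient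
step (`quotientStep_of_isRegularWeightedCentre`), blow-up downstairs, and the induction hypothesis at
the successor pair by `(term)`. [cite: Wlodarczyk2022, Thm 1.1.4 (5), Thm 1.1.6; BerghRydh2019, Thm 5] -/
theorem hasResolution_quotient_of_gradedAtlas
    (E : TerminatingCentreDatum p) {k : Type} [Field k] [CharP k p] [PerfectField k]
    (hBR : ∀ (V : Scheme.{0}) (g : V ⟶ Spec (.of k)) [IsIntegral V] [IsSeparated g]
      [LocallyOfFiniteType g] [QuasiCompact g],
      (∀ v : V, ∃ (A : Type) (_ : AddCommGroup A) (_ : Finite A) (_ : DecidableEq A)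
        (S : Type) (_ : CommRing S) (_ : Algebra k S) (𝒮 : A → Submodule k S)
        (_ : GradedAlgebra 𝒮), Algebra.FiniteType k S ∧ Algebra.Smooth k S ∧
        ∃ φ : Spec (.of (𝒮 0)) ⟶ V, Etale φ ∧ v ∈ Set.range φ ∧
          φ ≫ g = Spec.map (CommRingCat.ofHom (algebraMap k (𝒮 0)))) →
      Scheme.HasResolution V)
    (Y : Scheme.{0}) (f : Y ⟶ Spec (.of k)) [Smooth f] [IsSeparated f] [QuasiCompact f]
    (I : Y.IdealSheafData) :
    ∀ (X V : Scheme.{0}) (i : X ⟶ Y) [IsClosedImmersion i] [IsIntegral X], i.ker = I →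
      ∀ (g : V ⟶ Spec (.of k)) [IsSeparated g] [LocallyOfFiniteType g] [QuasiCompact g]
        [IsIntegral V] (q : X ⟶ V), q ≫ g = i ≫ f → ∀ (j : ℕ), GradedAtlas j f i q →
        Scheme.HasResolution V := by
  have key := E.rank_induction
    (fun (Y : Scheme.{0}) (f : Y ⟶ Spec (.of k)) (I : Y.IdealSheafData) =>
      ∀ [Smooth f] [IsSeparated f] [QuasiCompact f] (X V : Scheme.{0}) (i : X ⟶ Y)
        [IsClosedImmersion i] [IsIntegral X], i.ker = I →
        ∀ (g : V ⟶ Spec (.of k)) [IsSeparated g] [LocallyOfFiniteType g] [QuasiCompact g]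
          [IsIntegral V] (q : X ⟶ V), q ≫ g = i ≫ f → ∀ (j : ℕ), GradedAtlas j f i q →
          Scheme.HasResolution V) ?base ?step Y f I
  · exact fun X V i _ _ hIeq g _ _ _ _ q hq j 𝒜 => key X V i hIeq g q hq j 𝒜
  · -- base: `inv` everywhere minimal ⇒ `X` regular ⇒ quotient singularities ⇒ Bergh–Rydh over `k`
    intro Y f _ _ _ I hbot _ _ _ X V i _ _ hIeq g _ _ _ _ q hq j 𝒜
    subst hIeq
    have hreg : Scheme.IsRegular X := (E.isRegular_iff_forall_isBot_inv f i).mpr hbot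
    exact hBR V g (DatumToEmbedded.quotientSingularities_of_regular f i q g hq hreg 𝒜)
  · -- step
    intro Y f _ _ _ I hguard ih _ _ _ X V i _ _ hIeq g _ _ _ _ q hq j 𝒜
    subst hIeq
    haveI : IsLocallyNoetherian Y := LocallyOfFiniteType.isLocallyNoetherian f
    -- the centre is a regular weighted centre missing the generic point of `X`
    have hc : (E.centre f i.ker).IsRegularWeightedCentre :=
      E.isRegularWeightedCentre_centre f i.ker hguard
    have hξ : i (genericPoint X) ∉ (E.centre f i.ker).support :=
      E.genericPoint_not_mem_support_centre f i hguard
    -- the Rees filtration of the centre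
    let R' : ReesFiltration Y :=
      { ideal := (E.centre f i.ker).piece
        ideal_zero := (E.centre f i.ker).piece_zero
        antitone := antitone_piece hc
        mul_le := (E.centre f i.ker).piece_mul_le }
    -- the new ambient is smooth separated quasi-compact
    obtain ⟨hsm', hsep', hqc'⟩ :=
      WeightedThesis.GlobalCobordantPlus.smooth_πPlus_comp_of_isRegularWeightedCentre f
        (E.centre f i.ker) hc R' rfl
    haveI := hsm'; haveI := hsep'; haveI := hqc'
    -- the strict transform is integral and lies over `X`
    obtain ⟨hint', hker⟩ :=
      DatumToEmbedded.StrictTransform.isIntegral_strictTransformPlus_of_not_mem_support i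
        (E.centre f i.ker) hc R' rfl hξ
    haveI := hint'
    set I' := R'.strictTransformPlus i.ker with hI'
    let i' := I'.subschemeι
    let σX : I'.subscheme ⟶ X := IsClosedImmersion.lift i (i' ≫ R'.πPlus) hker
    have hσX : σX ≫ i = i' ≫ R'.πPlus := IsClosedImmersion.lift_fac _ _ _
    -- homogeneity of the centre on the charts (axiom `(hom)`), then the quotient step
    have hhom := fun (a : 𝒜.ι) (n : ℕ) =>
      @TerminatingCentreDatum.centre_isHomogeneous p E k _ _ _ Y f _ _ _ i.ker hguard j (𝒜.W a)
        (𝒜.piece a) (𝒜.gradedRing a) (𝒜.appLE_mem a) (𝒜.isHomogeneous_ker a) n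
    obtain ⟨K, hK, hstep⟩ := DatumToEmbedded.quotientStep_of_isRegularWeightedCentre f i q g hq 𝒜
      (E.centre f i.ker) hc hξ hhom R' rfl σX hσX
    -- blow `V` up along `K`
    obtain ⟨V', ρ, hρ⟩ := exists_isBlowup V K
    haveI : IsLocallyNoetherian V := LocallyOfFiniteType.isLocallyNoetherian g
    haveI : IsProper ρ := hρ.isProper
    have hbir : IsBirational ρ := hρ.isBirational' hK
    haveI : IsIntegral V' := hρ.isIntegral hK
    obtain ⟨q', hq', ⟨𝒜'⟩⟩ := hstep V' ρ hρ
    -- the rank drops (axiom `(term)`), and the induction hypothesis resolves `V'`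
    have hdrop : E.rank (R'.πPlus ≫ f) I' < E.rank f i.ker := E.rank_lt f i.ker hguard R' rfl
    have hV' : Scheme.HasResolution V' := by
      have hQ' := ih (R'.plus : Scheme.{0}) (R'.πPlus ≫ f) I' hdrop
      refine hQ' I'.subscheme V' i' (Scheme.IdealSheafData.ker_subschemeι I') (ρ ≫ g) q' ?_
        (j + 1) 𝒜'
      rw [← Category.assoc, hq', Category.assoc, hq, ← Category.assoc, hσX, Category.assoc]
    exact Scheme.HasResolution.of_isBirational ρ hbir hV'

/-- **A terminating centre datum in characteristic `p` and Bergh–Rydh over the perfect field `k` of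
characteristic `p` resolve every integral closed subscheme of every smooth separated quasi-compact
`k`-scheme** (the tower on the trivial presentation `q = 𝟙 X` of rank `0`,
`DatumToEmbedded.InitialAtlas.stub_initialAtlas`). [cite: Wlodarczyk2022, Thm 1.1.6; BerghRydh2019, Thm 5] -/
theorem hasResolution_of_closedImmersion
    (E : TerminatingCentreDatum p) {k : Type} [Field k] [CharP k p] [PerfectField k]
    (hBR : ∀ (V : Scheme.{0}) (g : V ⟶ Spec (.of k)) [IsIntegral V] [IsSeparated g]
      [LocallyOfFiniteType g] [QuasiCompact g],
      (∀ v : V, ∃ (A : Type) (_ : AddCommGroup A) (_ : Finite A) (_ : DecidableEq A)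
        (S : Type) (_ : CommRing S) (_ : Algebra k S) (𝒮 : A → Submodule k S)
        (_ : GradedAlgebra 𝒮), Algebra.FiniteType k S ∧ Algebra.Smooth k S ∧
        ∃ φ : Spec (.of (𝒮 0)) ⟶ V, Etale φ ∧ v ∈ Set.range φ ∧
          φ ≫ g = Spec.map (CommRingCat.ofHom (algebraMap k (𝒮 0)))) →
      Scheme.HasResolution V)
    {Y X : Scheme.{0}} (f : Y ⟶ Spec (.of k)) [Smooth f] [IsSeparated f] [QuasiCompact f]
    (i : X ⟶ Y) [IsClosedImmersion i] [IsIntegral X] :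
    Scheme.HasResolution X := by
  obtain ⟨𝒜₀⟩ := DatumToEmbedded.InitialAtlas.stub_initialAtlas f i
  haveI : IsSeparated (i ≫ f) := inferInstance
  haveI : LocallyOfFiniteType (i ≫ f) := inferInstance
  haveI : QuasiCompact (i ≫ f) := inferInstance
  exact hasResolution_quotient_of_gradedAtlas E hBR Y f i.ker X X i rfl (i ≫ f) (𝟙 X)
    (Category.id_comp _) 0 𝒜₀

end TerminatingCentreDatum

end Summit.ResolutionOfSingularities.ResolutionOfSingularities.Theorems

end
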